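import Literature.NumberTheory.EllipticCurves.KubertTateFiveMuDescentNumberFieldValuation
import Literature.NumberTheory.EllipticCurves.KubertTateFiveSelmerTameGaussian
import HarnessLib

/-!
# The `5`-descent on the Kubert–Tate family `E_{m,n}` over `ℚ(i)`, III: the Gaussian tame régime —
# `#Sel^ψ = #(E(ℚ(i))/5E(ℚ(i))) · #ker Ш(ψ)`, `rank E_{m,n}(ℚ(i)) + 1 ≤ #S`, and `Ш(E_{m,n}/ℚ(i))[5^∞] = 0`
# when the `ℚ(i)`-points fill the box

PROOF-ONLY file (theorems only, no definition, no named fact, no `sorry`), topic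
`NumberTheory/EllipticCurves`; the base field is `K = ℚ(i) = ℚ(ζ₄)` (any `K` with `IsCyclotomicExtension {4} ℚ K`).
It assembles the two sides of the `5`-isogeny descent of `E_{m,n} = [n-m, -mn, -mn², 0, 0]` over `ℚ(i)` built in
the tree: the `ℤ/5`-side `KubertTateFiveSelmerTameGaussian` (`Sel^φ(E/ℚ(i)) = 0` when `5 ∤ Δ` and every bad prime
`ℓ` has `ℓ ≢ 1 (mod 5)`, `ℓ ≡ 4 (mod 5) ⇒ ℓ ≡ 1 (mod 4)`) and the `μ₅`-side
`KubertTateFiveMuDescentNumberFieldValuation` (`#Sel^ψ(E'/ℚ(i)) ≤ 5 ^ #S` for any finite set `S` of places off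
which `m, n` are units), exactly as §4 of the tree's `KubertTateFiveMuDescent` does over `ℚ`:

* `range_pointHom_dual_eq`, `natCard_selmerGroup_dual_eq` — `ψ(E'(K)) = 5E(K)` and
  `#Sel^ψ = #(E(K)/5E(K)) · #ker Ш(ψ)` (Silverman X.4.2(a));
* `natCard_quotient_le`, **`pow_mordellWeilRank_succ_le`**, `mordellWeilRank_succ_le` —
  `#(E(K)/5E(K)) ≤ 5 ^ #S`, hence **`rank E_{m,n}(ℚ(i)) + 1 ≤ #S`** (`T = (0,0) ∈ E(K)[5]`);
* when the `K`-points FILL the box (`5 ^ #S ≤ #(E(K)/5E(K))`): (`ker Ш(ψ) = 0`, private)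
  **`sha_torsionBy_five_eq_bot_of_le`** (`Ш(E_{m,n}/ℚ(i))[5] = 0`), **`shaCorank_five_eq_zero_of_le`**
  (`t₅(E_{m,n}/ℚ(i)) = 0`), `primaryComponent_sha_five_eq_bot_of_le`, `natCard_quotient_eq_of_le`.

Since `Sel₅(E/ℚ(i)) = Sel₅(E/ℚ) ⊕ Sel₅(E^{(-1)}/ℚ)` and `rank E(ℚ(i)) = rank E(ℚ) + rank E^{(-1)}(ℚ)`, a full box
over `ℚ(i)` certifies at once `t₅(E_{m,n}) = 0` and `t₅(E_{m,n}^{(-1)}) = 0` — the door at `5` on the quadratic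
twists by `-1` of the Kubert–Tate curves (curves WITHOUT a rational `5`-torsion point), the instrument named for
the load-bearing slice of the transfer statement T (stmt-BirchSwinnertonDyer-22356).  BSD is not proved by this.

## References

* [SilvermanAEC2009] J. H. Silverman, *AEC*, 2nd ed., Thm. X.4.2, Prop. X.4.9, Exercise 10.1(c).
* [Fisher2001FiveSevenDescent] T. Fisher, JEMS 3 (2001), §§1–2.
* [Mazur1977] B. Mazur, *Modular curves and the Eisenstein ideal*, Ch. III §3 Thm. (3.1).
-/

noncomputable section

open scoped Classical NNReal NumberField AddSubgroup
open WeierstrassCurve WeierstrassCurve.Isogeny Field IsDedekindDomain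
open Literature.NumberTheory.EllipticCurves Literature.NumberTheory.EllipticCurves.KubertTateKummer
  Literature.NumberTheory.EllipticCurves.KubertTateVelu Literature.NumberTheory.GaloisRepresentations
  Literature.NumberTheory.NumberFields

namespace Literature.NumberTheory.EllipticCurves

namespace KubertTateMuDescentNF

variable {K : Type} [Field K] [NumberField K] [IsCyclotomicExtension {4} ℚ K]
variable (m n : ℤ) [hE : (kubertTateFive (m : K) (n : K)).IsElliptic]
variable (ψ : Isogeny (kubertTateFive' (m : K) (n : K)) (kubertTateFive (m : K) (n : K)))
  (hψ : ∀ P, ψ (fiveIsogeny (m : K) (n : K) P) = ((5 : ℕ) : ℤ) • P)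
variable (P₁ : geomPoints (kubertTateFive (m : K) (n : K)))
  (hP₁ : ∀ σ : absoluteGaloisGroup K, σ • P₁ = P₁) (h25 : ((25 : ℕ) : ℤ) • P₁ ≠ 0)

/-! ## §4 The tame régime: `#Sel^ψ = #(E(K)/5E(K)) · #ker Ш(ψ)`, `rank ≤ #S − 1`, and `Ш[5] = 0` when the box is full -/

section Tame

variable (S : Finset (HeightOneSpectrum (𝓞 K)))
  (hS : ∀ v : HeightOneSpectrum (𝓞 K), v ∉ S → ((m : ℤ) : 𝓞 K) ∉ v.asIdeal ∧ ((n : ℤ) : 𝓞 K) ∉ v.asIdeal)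
  (h5 : ¬ (5 : ℤ) ∣ (kubertTateFive m n).Δ)
  (hbad : ∀ ℓ : ℕ, ℓ.Prime → (ℓ : ℤ) ∣ (kubertTateFive m n).Δ → ℓ % 5 ≠ 1 ∧ (ℓ % 5 = 4 → ℓ % 4 = 1))

include hψ h5 hbad in
/-- **`ψ(E'(K)) = 5E(K)` in the tame régime**: `E'(K) = φ(E(K))` (`Sel^φ = 0`, tree
`KubertTateVelu.selmerGroup_fiveIsogeny_eq_bot_gaussian`) and `ψ ∘ φ = [5]`. [cite: SilvermanAEC2009, Thm. X.4.2(a)]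
[cite: Mazur1977, Ch. III §3 Thm. (3.1)] -/
theorem range_pointHom_dual_eq
    (g : (kubertTateFive' (m : K) (n : K)).toAffine.Point →+ (kubertTateFive (m : K) (n : K)).toAffine.Point)
    (hg : ∀ P', toGeomPoints _ (g P') = ψ (toGeomPoints _ P')) :
    g.range = (nsmulAddMonoidHom (5 : ℕ) :
      (kubertTateFive (m : K) (n : K)).toAffine.Point →+ (kubertTateFive (m : K) (n : K)).toAffine.Point).range := by
  obtain ⟨f, hf⟩ := (fiveIsogeny (m : K) (n : K)).exists_pointHom
  have hgf : ∀ P : (kubertTateFive (m : K) (n : K)).toAffine.Point, g (f P) = (5 : ℕ) • P := fun P ↦ by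
    apply toGeomPoints_injective (kubertTateFive (m : K) (n : K))
    rw [hg, hf, hψ, map_nsmul, natCast_zsmul]
  ext Q
  constructor
  · rintro ⟨P', rfl⟩
    obtain ⟨P, hP⟩ := ConstantKernelDescent.exists_toGeomPoints_eq_of_selmerGroup_eq_bot
      (fiveIsogeny (m : K) (n : K)) (KubertTateVelu.selmerGroup_fiveIsogeny_eq_bot_gaussian m n h5 hbad) P'
    have hP' : P' = f P := toGeomPoints_injective (kubertTateFive' (m : K) (n : K)) (by rw [hP, hf])
    exact ⟨P, by rw [nsmulAddMonoidHom_apply, hP', hgf]⟩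
  · rintro ⟨P, rfl⟩
    exact ⟨f P, by rw [nsmulAddMonoidHom_apply, hgf]⟩

include hψ h5 hbad in
/-- **`#Sel^ψ(E'/K) = #(E(K)/5E(K)) · #ker Ш(ψ)` in the tame régime** (Silverman X.4.2(a) counted, tree
`Isogeny.natCard_selmerGroup_eq`, with `ψ(E'(K)) = 5E(K)`). [cite: SilvermanAEC2009, Thm. X.4.2(a)] -/
theorem natCard_selmerGroup_dual_eq :
    Nat.card ψ.selmerGroup =
      Nat.card ((kubertTateFive (m : K) (n : K)).toAffine.Point ⧸ (nsmulAddMonoidHom (5 : ℕ) :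
        (kubertTateFive (m : K) (n : K)).toAffine.Point →+ (kubertTateFive (m : K) (n : K)).toAffine.Point).range) *
      Nat.card (shaMap ψ.toAddMonoidHom ψ.equivariant ψ.hasLocalPointsMaps_toAddMonoidHom).ker := by
  obtain ⟨g, hg⟩ := ψ.exists_pointHom
  rw [ψ.natCard_selmerGroup_eq g hg, range_pointHom_dual_eq m n ψ hψ h5 hbad g hg, AddSubgroup.index_eq_card]

omit [IsCyclotomicExtension {4} ℚ K] in
include hψ in
/-- `ker Ш(ψ)` is finite (it embeds in `Ш(E'/K)[5]`, finite by weak Mordell–Weil; tree `finite_ker_shaMap`).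
[cite: SilvermanAEC2009, Thm. X.4.2(b)] -/
private theorem finite_ker_shaMap_dual :
    Finite (shaMap ψ.toAddMonoidHom ψ.equivariant ψ.hasLocalPointsMaps_toAddMonoidHom).ker :=
  (finite_ker_shaMap ψ.toAddMonoidHom ψ.equivariant ψ.hasLocalPointsMaps_toAddMonoidHom
    (fiveIsogeny (m : K) (n : K)).toAddMonoidHom (fiveIsogeny (m : K) (n : K)).equivariant (n := 5) (by norm_num)
    (fun Q ↦ by rw [Isogeny.coe_toAddMonoidHom, Isogeny.coe_toAddMonoidHom, comp_dual_eq m n ψ hψ Q])).to_subtype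

include hψ hP₁ h25 S hS h5 hbad in
/-- **`#(E(K)/5E(K)) ≤ 5 ^ #S` in the tame régime** (from `#Sel^ψ ≤ 5 ^ #S` and `#ker Ш(ψ) ≥ 1`).
[cite: SilvermanAEC2009, Thm. X.4.2 and Prop. X.4.9] [cite: Fisher2001FiveSevenDescent, §2] -/
theorem natCard_quotient_le :
    Nat.card ((kubertTateFive (m : K) (n : K)).toAffine.Point ⧸ (nsmulAddMonoidHom (5 : ℕ) :
        (kubertTateFive (m : K) (n : K)).toAffine.Point →+ (kubertTateFive (m : K) (n : K)).toAffine.Point).range) ≤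
      5 ^ S.card := by
  haveI := finite_ker_shaMap_dual m n ψ hψ
  have h := natCard_selmerGroup_dual_le_of_support m n ψ hψ P₁ hP₁ h25 S hS
  rw [natCard_selmerGroup_dual_eq m n ψ hψ h5 hbad] at h
  have hpos : 0 < Nat.card (shaMap ψ.toAddMonoidHom ψ.equivariant ψ.hasLocalPointsMaps_toAddMonoidHom).ker :=
    Nat.card_pos
  nlinarith

include hψ hP₁ h25 S hS h5 hbad in
/-- **`5 ^ (rank E_{m,n}(K) + 1) ≤ 5 ^ #S`, i.e. `rank E_{m,n}(K) ≤ #S − 1`, in the tame régime**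
(`#(E(K)/5E(K)) = 5^rank · #E(K)[5]`, tree `natCard_quotient_nsmulRange_eq`, and `T ∈ E(K)[5]` has order `5`).
[cite: SilvermanAEC2009, Thm. X.4.2 and Prop. X.4.9] [cite: Fisher2001FiveSevenDescent, §2] -/
theorem pow_mordellWeilRank_succ_le :
    5 ^ ((kubertTateFive (m : K) (n : K)).mordellWeilRank + 1) ≤ 5 ^ S.card := by
  haveI : Module.Finite ℤ (kubertTateFive (m : K) (n : K)).toAffine.Point := by
    convert module_finite_point_holds (kubertTateFive (m : K) (n : K))
  have hcard := natCard_quotient_nsmulRange_eq (kubertTateFive (m : K) (n : K)).toAffine.Point 5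
  have hle := natCard_quotient_le m n ψ hψ P₁ hP₁ h25 S hS h5 hbad
  rw [hcard] at hle
  -- `#E(K)[5] ≥ 5`: the rational point `(0,0)` has order `5`
  obtain ⟨hm0, hn0, -⟩ := ne_zero_of_isElliptic (m : K) (n : K)
  obtain ⟨T, hT⟩ := exists_addOrderOf_eq_five_kubertTateFive hm0 hn0
  have h5T : 5 ≤ Nat.card (AddSubgroup.torsionBy (kubertTateFive (m : K) (n : K)).toAffine.Point ((5 : ℕ) : ℤ)) := by
    -- `E(K)[5] ↪ E(K̄)[5]`, finite
    haveI : Finite (AddSubgroup.torsionBy (kubertTateFive (m : K) (n : K)).toAffine.Point ((5 : ℕ) : ℤ)) :=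
      Literature.NumberTheory.EllipticCurves.finite_torsionBy_of_injective
        (toGeomPoints (kubertTateFive (m : K) (n : K))) (toGeomPoints_injective _) _
        (WeierstrassCurve.finite_torsionBy_of_isAlgClosed
          (V := (kubertTateFive (m : K) (n : K)).baseChange (AlgebraicClosure K)) (by norm_num))
    have hsub : AddSubgroup.zmultiples T ≤ AddSubgroup.torsionBy _ ((5 : ℕ) : ℤ) := by
      rw [AddSubgroup.zmultiples_le, mem_torsionBy_iff, natCast_zsmul, ← hT, addOrderOf_nsmul_eq_zero]
    have := AddSubgroup.card_le_of_le hsub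
    rwa [Nat.card_zmultiples, hT] at this
  have hr : (kubertTateFive (m : K) (n : K)).mordellWeilRank =
      Module.finrank ℤ (kubertTateFive (m : K) (n : K)).toAffine.Point := by
    unfold WeierstrassCurve.mordellWeilRank; congr!
  rw [hr, pow_succ]
  calc 5 ^ Module.finrank ℤ (kubertTateFive (m : K) (n : K)).toAffine.Point * 5
      ≤ 5 ^ Module.finrank ℤ (kubertTateFive (m : K) (n : K)).toAffine.Point *
          Nat.card (AddSubgroup.torsionBy (kubertTateFive (m : K) (n : K)).toAffine.Point ((5 : ℕ) : ℤ)) :=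
        Nat.mul_le_mul_left _ h5T
    _ ≤ 5 ^ S.card := hle

include hψ hP₁ h25 S hS h5 hbad in
/-- **`rank E_{m,n}(K) + 1 ≤ #S` in the tame régime** (with a rational point of infinite order present).
[cite: SilvermanAEC2009, Thm. X.4.2 and Prop. X.4.9] [cite: Fisher2001FiveSevenDescent, §2] -/
theorem mordellWeilRank_succ_le :
    (kubertTateFive (m : K) (n : K)).mordellWeilRank + 1 ≤ S.card :=
  (Nat.pow_le_pow_iff_right (by norm_num)).mp (pow_mordellWeilRank_succ_le m n ψ hψ P₁ hP₁ h25 S hS h5 hbad)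

variable (hbox : 5 ^ S.card ≤
  Nat.card ((kubertTateFive (m : K) (n : K)).toAffine.Point ⧸ (nsmulAddMonoidHom (5 : ℕ) :
    (kubertTateFive (m : K) (n : K)).toAffine.Point →+ (kubertTateFive (m : K) (n : K)).toAffine.Point).range))

include hψ hP₁ h25 S hS h5 hbad hbox in
/-- **`Ш(E'/K)[ψ] = 0` when the rational points fill the box**: if `#(E(K)/5E(K)) ≥ 5 ^ #S` then
`#(E(K)/5E(K)) · #ker Ш(ψ) = #Sel^ψ ≤ 5 ^ #S` forces `ker Ш(ψ) = ⊥`. [cite: SilvermanAEC2009, Thm. X.4.2(a) and Prop. X.4.9]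
[cite: Fisher2001FiveSevenDescent, §2] -/
private theorem ker_shaMap_dual_eq_bot_of_le :
    (shaMap ψ.toAddMonoidHom ψ.equivariant ψ.hasLocalPointsMaps_toAddMonoidHom).ker = ⊥ := by
  haveI := finite_ker_shaMap_dual m n ψ hψ
  have h := natCard_selmerGroup_dual_le_of_support m n ψ hψ P₁ hP₁ h25 S hS
  rw [natCard_selmerGroup_dual_eq m n ψ hψ h5 hbad] at h
  have hpos : 0 < Nat.card (shaMap ψ.toAddMonoidHom ψ.equivariant ψ.hasLocalPointsMaps_toAddMonoidHom).ker :=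
    Nat.card_pos
  set N₀ := Nat.card (shaMap ψ.toAddMonoidHom ψ.equivariant ψ.hasLocalPointsMaps_toAddMonoidHom).ker with hN₀
  set Q := Nat.card ((kubertTateFive (m : K) (n : K)).toAffine.Point ⧸ (nsmulAddMonoidHom (5 : ℕ) :
    (kubertTateFive (m : K) (n : K)).toAffine.Point →+ (kubertTateFive (m : K) (n : K)).toAffine.Point).range) with hQ
  have hQpos : 0 < Q := lt_of_lt_of_le (pow_pos (by norm_num) _) hbox
  have hK1 : N₀ ≤ 1 := by
    by_contra hK1
    have hK2 : 2 ≤ N₀ := Nat.succ_le_of_lt (lt_of_not_ge hK1)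
    have h2 : Q * 2 ≤ Q := (Nat.mul_le_mul_left Q hK2).trans (h.trans hbox)
    linarith
  have hone : N₀ = 1 := le_antisymm hK1 (Nat.succ_le_of_lt hpos)
  exact AddSubgroup.eq_bot_of_card_eq _ hone

include h5 hbad hP₁ h25 hS hbox in
/-- **`Ш(E_{m,n}/K)[5] = 0` when the rational points fill the box** — the complete `5`-descent in the tame régime:
`Ш(E)[φ] = 0` (tree `KubertTateVelu.ker_shaMap_fiveIsogeny_eq_bot_gaussian`) and `Ш(E')[ψ] = 0` bracket `Ш(E)[5]`
(tree `sha_torsionBy_eq_bot_of_ker_shaMap_eq_bot`). [cite: SilvermanAEC2009, Thm. X.4.2(a)] [cite: Fisher2001FiveSevenDescent, §2] -/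
theorem sha_torsionBy_five_eq_bot_of_le : (kubertTateFive (m : K) (n : K)).sha[((5 : ℕ) : ℤ)] = ⊥ := by
  obtain ⟨ψ, hψ⟩ := exists_dual (K := K) m n
  exact sha_torsionBy_eq_bot_of_ker_shaMap_eq_bot (fiveIsogeny (m : K) (n : K)) ψ (n := 5) (by norm_num) hψ
    (ConstantKernelDescent.ker_shaMap_eq_bot_of_selmerGroup_eq_bot (fiveIsogeny (m : K) (n : K))
      (KubertTateVelu.selmerGroup_fiveIsogeny_eq_bot_gaussian m n h5 hbad))
    (ker_shaMap_dual_eq_bot_of_le m n ψ hψ P₁ hP₁ h25 S hS h5 hbad hbox)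

include h5 hbad hP₁ h25 hS hbox in
/-- `Ш(E_{m,n}/K)` has no element of order `5` (box full, tame). [cite: SilvermanAEC2009, Thm. X.4.2(a)] -/
theorem forall_mem_sha_five_nsmul_eq_zero_of_le :
    ∀ c ∈ (kubertTateFive (m : K) (n : K)).sha, (5 : ℕ) • c = 0 → c = 0 := by
  intro c hc h5c
  have hmem : (⟨c, hc⟩ : (kubertTateFive (m : K) (n : K)).sha) ∈ (kubertTateFive (m : K) (n : K)).sha[((5 : ℕ) : ℤ)] :=
    AddSubgroup.torsionBy.nsmul_iff.mpr (Subtype.ext h5c)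
  rw [sha_torsionBy_five_eq_bot_of_le m n P₁ hP₁ h25 S hS h5 hbad hbox, AddSubgroup.mem_bot] at hmem
  exact congrArg Subtype.val hmem

include h5 hbad hP₁ h25 hS hbox in
/-- **`t₅(E_{m,n}) = corank_{ℤ₅} Ш(E_{m,n}/K)[5^∞] = 0` when the rational points fill the box (tame régime)** —
by descent alone, at any Mordell–Weil rank. [cite: SilvermanAEC2009, Thm. X.4.2(a)] [cite: Fisher2001FiveSevenDescent, §2] -/
theorem shaCorank_five_eq_zero_of_le : (kubertTateFive (m : K) (n : K)).shaCorank 5 = 0 :=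
  (kubertTateFive (m : K) (n : K)).shaCorank_eq_zero_of_forall 5
    (forall_mem_sha_five_nsmul_eq_zero_of_le m n P₁ hP₁ h25 S hS h5 hbad hbox)

include h5 hbad hP₁ h25 hS hbox in
/-- **`Ш(E_{m,n}/K)[5^∞] = 0`** when the rational points fill the box (tame régime). [cite: SilvermanAEC2009, Thm. X.4.2(a)] -/
theorem primaryComponent_sha_five_eq_bot_of_le :
    AddCommGroup.primaryComponent (kubertTateFive (m : K) (n : K)).sha 5 = ⊥ :=
  (kubertTateFive (m : K) (n : K)).primaryComponent_sha_eq_bot_of_forall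
    (forall_mem_sha_five_nsmul_eq_zero_of_le m n P₁ hP₁ h25 S hS h5 hbad hbox)

include h5 hbad hP₁ h25 hS hbox in
/-- … and the box is then EXACTLY full: `#(E(K)/5E(K)) = 5 ^ #S`. [cite: SilvermanAEC2009, Thm. X.4.2(a)] -/
theorem natCard_quotient_eq_of_le :
    Nat.card ((kubertTateFive (m : K) (n : K)).toAffine.Point ⧸ (nsmulAddMonoidHom (5 : ℕ) :
        (kubertTateFive (m : K) (n : K)).toAffine.Point →+ (kubertTateFive (m : K) (n : K)).toAffine.Point).range) =
      5 ^ S.card := by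
  obtain ⟨ψ, hψ⟩ := exists_dual (K := K) m n
  exact le_antisymm (natCard_quotient_le m n ψ hψ P₁ hP₁ h25 S hS h5 hbad) hbox

end Tame

end KubertTateMuDescentNF

end Literature.NumberTheory.EllipticCurves

end
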